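import Summits.PneNP.PneNP.Theorems.ConvexRankGatesConvexGateBlindXorDefs
import Summits.PneNP.PneNP.Theorems.ConvexRankGatesConvexGateBlindStubTransport
import Summits.PneNP.PneNP.Theorems.ConvexRankGatesConvexGateBlindStubXorCanonical
import Summits.PneNP.PneNP.Theorems.ConvexRankGatesConvexGateBlindStubEmbedding
import Summits.PneNP.PneNP.Theorems.ConvexRankGatesConvexGateBlindStubCliqueProjectsXor
import Summits.PneNP.PneNP.Theorems.ConvexRankGatesConvexGateBlindStubPerfectCompleteness

/-!
# Line `xor-door-perfect-completeness` — crux `ConvexGateBlind` (stmt-PneNP-10680, route PneNP/ConvexRankGates)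

Skeleton, lead's revision 2 (2026-08-16, prover-line-stmt-PneNP-10680-0). The vocabulary of the line lives in
`Theorems/ConvexRankGatesConvexGateBlindXorDefs.lean` (namespace `Summit.PneNP.PneNP.Theorems.XorDoor`) and FIVE of the
six registered stubs are LANDED theorems there:

* `stub_cliqueProjectsXor : XorIsCliqueProjection` — `…StubCliqueProjectsXor.lean` (+ `…Helpers.lean`): 3XOR-UNSAT on the
  3-sparse pool is a monotone AND-projection of `CLIQUE(M, k)`, `M ≤ (n+3)^8` (derivation gadget, ZMod 2 duality);
* `stub_transport : Transport` — `…StubTransport.lean`: CONV-blindness descends along polynomial monotone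
  AND-projections of CLIQUE (δ = 1/4, apex + isolated padding, `Padding.lean` toolkit);
* `stub_xorCanonical : XorConeRankHardEv → Xor3UnsatConvBlind` — `…StubXorCanonical.lean`: the XOR copy of the canonical
  cone-rank form (collapse to one CONV gate, wiring into `B`, trace-bounded Farkas certificates, uniform margin);
* `stub_embedding : ExactLifting → PerfectCompleteness → XorConeRankHardEv` — `…StubEmbedding.lean`: XOR ∘ Index = XOR,
  the Index-lift is a submatrix of the big distance matrix, `t = n / m → ∞` uniformly in `ε`;
* `stub_perfectCompleteness : PerfectCompleteness` — `…StubPerfectCompleteness{Fourier,Functional,Honeycomb,HoneycombIso,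
  Sos,Main,}.lean`: for every degree `d` the odd-charge Tseitin system on the `6(d+1)` honeycomb torus carries a degree-`d`
  perfect-completeness SA+SOS pseudo-expectation (Grigoriev's functional; isoperimetry by rows and column-pair snakes).

The ONE open stub is `stub_exactLifting : ExactLifting` (ε-exact size-from-degree lifting for a fixed fooled inner function;
its LP half is an explicit instance of Hrubeš 2020 Open Problem 4, cf. `…ExactLiftingStrictRank.lean`,
`…ExactLiftingAnchored.lean`; fragment `…ExactLiftingBlockJunta.lean`). Consequently the sorry-free theorem
`XorDoor.convexGateBlind_of_exactLifting : ExactLifting → ConvexGateBlind` (Theorems/…XorDoorReduction.lean) is the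
line's deliverable to date.

Lead c1 (continuation, 2026-08-16, prover-line-stmt-PneNP-10680-c1-0): no reshape; two more supports for the open stub —
`…ExactLiftingOneSided.lean` (sub-goal `no_oneSidedJunta_shift`: the Index-lift contains the XOR-shift matrix, and no
decomposition of `viol_F(x[w]) − ε` into non-negative terms each block-junta on a side of its choice exists, any size) and
`…ExactLiftingSeparation.lean` (sub-goal `exactLifting_monotoneLP_bound`: Hrubeš's transfer in monotone promise form —
`ExactLifting` bounds every monotone LP gate separating planted copies of `F` from satisfied-lookup tables, the disprover's
exact target). Verdict (memo `ExactLifting-c1-analysis.md`, crux NOTES addendum): the stub is crux-sized both ways;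
handed back with `promote-stub`.

Lead c2 (continuation, 2026-08-16, prover-line-stmt-PneNP-10680-c2-0): no reshape (the stub set is right: five closed,
one open, composition kernel-checked). c2 works the SOS/PSD half of the calibration of `stub_exactLifting` (a pure
sum-of-squares certificate with squares of junta-degree `k` lifts to a PSD factorisation of size `O_F(t^k)`, so the
exponent is also bounded by the Gaussian width of the easiest fooled system; K₄-Tseitin: mixed-cone exponent ≤ 4 <
static SA degree 5) and the minimal-instance analysis; wave: none — 1 stub left.

Lead c3 (continuation, 2026-08-16, prover-line-stmt-PneNP-10680-c3-0): no reshape; wave: none — 1 stub left. c3 lands the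
LOWER edge of the exponent window of `stub_exactLifting`: `…ExactLiftingRankCornerCore.lean` (p109884, sub-goal
`character_dual_family`: the `±1` character sums over the three bits of a genuine triple are a dual family to the `t³`
columns of the shifted Index-lift), `…ExactLiftingRankCorner.lean` (p111199, sub-goal `exactLifting_exponent_one`:
`t³ ≤ q·q + r` for every cone factorisation of every real shift, hence `ExactLifting` verbatim with `φ ≡ 1`) and
`…ExactLiftingJuntaRigidity.lean` (p112510, sub-goal `junta_nmf_unique_explicit`: the `t³`-term non-negative
factorisation of the single-equation lift is unique — rigidity rung 0). The stub is now exactly "make the exponent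
unbounded"; memo `ExactLifting-c3.md` (continuity meta-obstacle, curve-selection rigidity form, negativity budget,
Hrubeš TR19-034 calibration); verdict unchanged: promote the stub, the line stays conditionally complete.

Lead c4 (continuation, 2026-08-16, prover-line-stmt-PneNP-10680-c4-0): no reshape; wave: none — 1 stub left. c4 lands the
UNIT-POTENTIAL LEVEL of the stub's matrix family with its exact exponent by an elementary, non-functional argument: the
Index-lift rectangle lemma (a rectangle `X × W` of the `(m,t)`-Index lift on which `x[w]` stays inside a set `Z ⊆ 𝔽₂^m`
containing no subcube of codimension `< κ` has `|X|·|W| ≤ 3^{m-1} t^{m-κ} 2^{mt}`), whence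
`rk₊(lift_t(viol_F) − J) ≥ c_F · t^{κ_F}` (`κ_F` = least codimension of a subcube of `{viol_F ≥ 2}`, `= 5` for every cubic
Tseitin system; K₄: `Θ(t⁵)` against `rk₊(lift_t viol_F) ≤ 4t³`), and the K₄ test instance; `stub_exactLifting` is exactly the
statement that the exponent of `ε ↦ rk₊(lift_t(viol_F) − εJ)`, which climbs from the rank corner to `κ_F` on `(0, 1]`, has
already left the corner at `ε = 0⁺`, uniformly in `d`.

Lead c5 (continuation, 2026-08-16, prover-line-stmt-PneNP-10680-c5-0): no reshape; wave: none — 1 stub left. c5 lands the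
TRIANGLE instance of record (`…ExactLiftingTriangle.lean`, sub-goal `triangle_window`: `M_t[x,w] = 1 + 2·[x₀(w₀)=x₁(w₁)=x₂(w₂)]`,
three blocks, cheap corner `3t²`, unit level `t³` exact, PSD-blind; open question of record `rk₊₊(M_t) ∈ [3t²−3t+1, t³+1]` =
"linear-size monotone LP for triangle-vs-bipartite?") and shows the K₄ instance is PSD-CHEAP (`…ExactLiftingK4SosTwo.lean`,
sub-goals `exactLifting_phi_three_le_two`, `no_juntaSos_shift_of_perfect`: the hand-found identity
`4·viol_{K4} − 2 = (χ₀+χ₁₂−χ₃₄)² + (χ₅−χ₁₃−χ₂₄)²` gives `viol_{K4} − ε` as a degree-2 junta-SOS for every `ε ≤ ½`, so the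
mixed-cone window of K₄ is `[3/2, 2]` and `φ(3) ≤ 2`, with the matching floor `k(F) > d/2` from any perfect Ẽ): the PSD half of
`stub_exactLifting` is calibrated by the junta-SOS degree `k(F) ∈ (d/2, width]`, the LP half keeps the triangle instance as its
minimal open model. Later in c5: the first ε-exact obstruction beyond junta classes — ASYMPTOTIC DEGREE-2 BLINDNESS of the
triangle instance (`…TriangleDegreeTwo{,Moments,Subcube,Blind}.lean`, sub-goals `anova2_pairing_bound`,
`degreeTwo_moment_identity`, `degreeTwo_line_conditions`, `triangle_degreeTwo_blind`): no exact factorisation of `M_t − εJ`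
with non-negative cross-block-degree-2 rows and non-negative interaction-free columns once `t > 12/ε − 8` (such plans exist at
t = 2, 3 by exact LPs); structural only — the count of terms never enters, so `rk₊₊(M_t)` stays open.

Lead c6 (continuation, 2026-08-17, prover-line-stmt-PneNP-10680-c6-0): no reshape; wave: none — 1 stub left. c6 lands the
MONO-HEAVINESS CALCULUS on the triangle instance, the first handle that is both ε-UNIFORM and a statement about a single atom of
an arbitrary factorisation (`…TriangleMonoHeavy.lean`, sub-goal `triangle_heavy_atom`: at a balanced colouring the weightless
dual `sgn = 𝟙[Mono] − 𝟙[Non]` kills mono lines, so every combination `monoCount − ε = Σ u_l v_l` with `u ≥ 0`, `ε > 0` has a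
MONO-HEAVY term `v_l(Mono) > v_l(Non)` — no hypothesis on atoms or number of terms; `…TriangleTwoDirBlind.lean`, sub-goal
`triangle_twoDir_blind`: non-negative two-directional atoms and interaction-free atoms vanishing on a plane are NEVER heavy,
hence for even `t ≥ 2` and every `ε > 0` no factorisation of `M_t − εJ` by such atoms exists, any number of terms;
`…TriangleLineSpread.lean`: ANOVA reconstruction `t³v = t²ℓ − tp + m` for interaction-free `v`, whence line-free
non-negative interaction-free atoms are line- and point-spread, and peeling lines never decreases heaviness).  Memo
`ExactLifting-c6.md`: LEMMA N (conjecture: an interaction-free `F ≥ 0` is heavy for `≤ 2^{−δt}` of the balanced rows;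
plane-spread case by Hoeffding twice) ⇒ THEOREM C (LP relaxations WITHOUT auxiliary variables need `2^{Ω(t)}` for every ε) and,
with the interaction-span lemma (`rank ΠV ≤ D − rank`), `rk₊(M_t − εJ) ≥ rank + Ω(t/log t)` ε-uniformly; a constants race
(near-point atoms are heavy for 1/4 of the rows) caps pure counting near `rank + O(t)`, so `3t² + 1` still needs exactness
beyond one functional per row.  Verdict unchanged: promote `stub_exactLifting`.
-/

set_option linter.dupNamespace false -- `Summit.PneNP.PneNP.…`: summit = sub-problem (D-0017)

namespace Summit.PneNP.PneNP.Cruxes.ConvexGateBlind.XorDoorPerfectCompleteness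

open Summit.PneNP.PneNP.Theorems.XorDoor
open Summit.PneNP.PneNP.Theses.ConvexRankGates (ConvexGateBlind)

/-! ## §1 The six registered stubs (five closed by landed theorems, one open) -/

/-- T1 (LANDED): 3XOR-UNSAT is a polynomial monotone AND-projection of CLIQUE. -/
theorem stub_cliqueProjectsXor : XorIsCliqueProjection :=
  Summit.PneNP.PneNP.Theorems.XorDoor.stub_cliqueProjectsXor

/-- T2 (LANDED): universality transport. -/
theorem stub_transport : Transport :=
  Summit.PneNP.PneNP.Theorems.XorDoor.stub_transport

/-- Canonical form for XOR (LANDED). -/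
theorem stub_xorCanonical : XorConeRankHardEv → Xor3UnsatConvBlind :=
  Summit.PneNP.PneNP.Theorems.XorDoor.stub_xorCanonical

/-- Embedding XOR ∘ Index = XOR (LANDED). -/
theorem stub_embedding : ExactLifting → PerfectCompleteness → XorConeRankHardEv :=
  Summit.PneNP.PneNP.Theorems.XorDoor.stub_embedding

/-- Perfect completeness at every degree (LANDED). -/
theorem stub_perfectCompleteness : PerfectCompleteness :=
  Summit.PneNP.PneNP.Theorems.XorDoor.stub_perfectCompleteness

/-- ε-exact lifting, asymptotic in the gadget size for a fixed fooled inner function (OPEN; the lead's stub). -/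
theorem stub_exactLifting : ExactLifting := by
  sorry

/-! ## §2 Registered alias and the composition -/

namespace __Registered

/-- Alias keyed by the registered stub name (the one open stub). -/
abbrev stub_exactLifting : Prop := ExactLifting

end __Registered

/-- **The line concludes the crux**: hypothesis = the one registered stub still open, by name; the five landed
stubs are discharged inside the proof by the tree theorems. -/
theorem ConvexGateBlind_of :
    __Registered.stub_exactLifting → Summit.PneNP.PneNP.Theses.ConvexRankGates.ConvexGateBlind :=
  fun hLift =>
    Summit.PneNP.PneNP.Theorems.XorDoor.stub_transport Pool xor3Unsat
      Summit.PneNP.PneNP.Theorems.XorDoor.stub_cliqueProjectsXor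
      (Summit.PneNP.PneNP.Theorems.XorDoor.stub_xorCanonical
        (Summit.PneNP.PneNP.Theorems.XorDoor.stub_embedding hLift
          Summit.PneNP.PneNP.Theorems.XorDoor.stub_perfectCompleteness))

/-- The composition fed with the stub itself. -/
example : Summit.PneNP.PneNP.Theses.ConvexRankGates.ConvexGateBlind :=
  ConvexGateBlind_of stub_exactLifting

/-! ## §3 The sorry-free deliverable lives in the tree

`Summit.PneNP.PneNP.Theorems.XorDoor.convexGateBlind_of_exactLifting : ExactLifting → ConvexGateBlind`
(`Theorems/ConvexRankGatesConvexGateBlindXorDoorReduction.lean`, proposal p95202) is the composition of the five landed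
stubs; it is not restated here so that `ConvexGateBlind_of` stays the unique crux-concluding theorem of the skeleton. -/

end Summit.PneNP.PneNP.Cruxes.ConvexGateBlind.XorDoorPerfectCompleteness
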